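import Literature.Computability.MetaComplexity.Resolution
import HarnessLib

/-!
# Resolution: the pigeonhole CNF is unsatisfiable (discharge of a named fact of `Resolution.lean`)

Sibling proof file of `Resolution.lean` (D-0014: named facts `def X : Prop` are discharged as
`theorem X_holds : X`; users' hypotheses `(h : X)` are then fed `X_holds`), next to
`ResolutionProofs.lean` (soundness / completeness / Tseitin width). It discharges

* `Literature.Computability.MetaComplexity.pigeonholeCNF_not_satisfiable_holds` — the
  pigeonhole CNF `pigeonholeCNF m n = PHP^m_n` (`m` pigeons, `n` holes) is unsatisfiable for
  `n < m`.

Source. A. Haken, *The intractability of resolution*, TCS 39 (1985), §1.5 ("Pigeonhole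
formulas", p. 300) defines the formulas `PF_n` ("`PF_n` encodes the principle that if `n`
pigeons sit in `n + 1` holes, there must be an empty hole"), with the variables arranged in an
`n × (n + 1)` array and `PF_n` stated dually, as a DNF to be shown a tautology: "the disjunction
of all possible clauses given by `n` by `n + 1` arrays with exactly one whole column of `−`s
and blanks everywhere else plus the clauses given by arrays with exactly two `+`s, both in the
same row". Lemma 1.2 there (p. 301, credited to Cook and Reckhow): "For all `n`, `PF_n` is a
tautology. *Proof.* If a truth assignment `V` for the variables of `PF_n` has two `1`s in some
row, then `V` is covered by a clause with `+`s in those two positions. If `V` has at most one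
`1` in each row, then the array for `V` contains at most `n` `1`s, so one of the `n + 1`
columns has only `0`s. Thus, `V` is covered by a clause with `−`s in that column." Negating,
this is exactly the unsatisfiability of the CNF `PHP^{n+1}_n` of `Resolution.lean` (its pigeon
clauses `⋁_j x_{ij}` are the negations of Haken's all-`−` columns, its hole clauses
`¬x_{ij} ∨ ¬x_{i'j}` the negations of his two-`+` rows; Haken's columns are the pigeons and his
rows the holes). The named fact is stated for all `m > n` (Krajíček, *Proof Complexity*, CUP
2019, §1.5: `PHP_n` is (1.5.1) with `n + 1` pigeons, and the remark after it on the variants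
with `m` pigeons, `m` "much larger than just `n + 1`", the weak PHP); the counting argument
printed by Haken works verbatim, with "at most `n` `1`s in `m > n` columns".

## Proof architecture

A satisfying assignment `σ` of `PHP^m_n` yields, from the pigeon clauses, for every `i < m` a
hole `f i < n` with `σ x_{i, f i} = 1` (`choose`); by the hole clauses (`i < i'` cannot share a
hole) the map `Fin m → Fin n, i ↦ f i` is injective, contradicting `n < m` via
`Fintype.card_le_of_injective`. No injectivity of the variable numbering `x_{ij} = i * n + j`
is needed: the pigeon and hole clauses mention literally the same variable terms.

## References

* A. Haken, The intractability of resolution, Theoret. Comput. Sci. 39 (1985) 297–308, §1.5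
  (pigeonhole formulas `PF_n`, p. 300), Lemma 1.2 (p. 301; `PF_n` is a tautology, credited to
  Cook–Reckhow).
* S. A. Cook, R. A. Reckhow, The relative efficiency of propositional proof systems,
  J. Symbolic Logic 44(1) (1979) 36–50 (the pigeonhole tautologies; Haken's reference [3]).
* J. Krajíček, *Proof Complexity*, Encyclopedia Math. Appl. 170, CUP 2019, §1.5, formula
  (1.5.1) (`PHP_n`) and the remark following it (variants with `m` pigeons, weak PHP).
-/

namespace Literature.Computability.MetaComplexity

open Complexity

/-- **The pigeonhole principle** (discharge of the named fact
`Literature.Computability.MetaComplexity.pigeonholeCNF_not_satisfiable`): `PHP^m_n` is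
unsatisfiable for `n < m`. A satisfying assignment `σ` gives, by the pigeon clauses, a map
`f : Fin m → Fin n` with `σ x_{i f(i)} = 1`, which is injective by the hole clauses —
impossible for `n < m` (`Fintype.card_le_of_injective`). This is Haken's Lemma 1.2 (credited
there to Cook–Reckhow), printed dually as "`PF_n` is a tautology" for `n + 1` pigeons and `n`
holes; the covering argument printed there is the one below and works for all `m > n`.
[cite: Haken1985, §1.5 (p. 300), Lemma 1.2 (p. 301)] -/
theorem pigeonholeCNF_not_satisfiable_holds : pigeonholeCNF_not_satisfiable := by
  intro m n hnm hsat
  obtain ⟨σ, hσ⟩ := hsat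
  rw [CNF.eval_eq_true_iff] at hσ
  -- pigeon clauses: every pigeon `i < m` sits in some hole `j < n`
  have hp : ∀ i < m, ∃ j < n, σ (i * n + j) = true := by
    intro i hi
    have hmem : ((List.range n).map fun j => (i * n + j, true)) ∈ pigeonholeCNF m n := by
      simp only [pigeonholeCNF, List.mem_append, List.mem_map, List.mem_flatMap, List.mem_range]
      exact Or.inl ⟨i, hi, rfl⟩
    simpa [Clause.eval, Literal.eval, List.any_eq_true] using hσ _ hmem
  -- hole clauses: no two pigeons `i < i'` share the hole `j`
  have hh : ∀ j < n, ∀ i' < m, ∀ i < i',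
      σ (i * n + j) = false ∨ σ (i' * n + j) = false := by
    intro j hj i' hi' i hi
    have hmem : [(i * n + j, false), (i' * n + j, false)] ∈ pigeonholeCNF m n := by
      simp only [pigeonholeCNF, List.mem_append, List.mem_map, List.mem_flatMap, List.mem_range]
      exact Or.inr ⟨j, hj, i', hi', i, hi, rfl⟩
    simpa [Clause.eval, Literal.eval] using hσ _ hmem
  choose f hf hσf using hp
  -- the hole map `Fin m → Fin n` is injective, contradicting `n < m`
  have hinj : Function.Injective fun i : Fin m => (⟨f i i.2, hf i i.2⟩ : Fin n) := by
    intro a b hab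
    have hab' : f a a.2 = f b b.2 := Fin.mk.inj_iff.1 hab
    by_contra hne
    have hne' : (a : ℕ) ≠ b := fun h => hne (Fin.ext h)
    rcases Nat.lt_or_gt_of_ne hne' with hlt | hlt
    · rcases hh (f a a.2) (hf a a.2) b b.2 a hlt with h | h
      · simp [hσf a a.2] at h
      · rw [hab'] at h
        simp [hσf b b.2] at h
    · rcases hh (f b b.2) (hf b b.2) a a.2 b hlt with h | h
      · simp [hσf b b.2] at h
      · rw [← hab'] at h
        simp [hσf a a.2] at h
  have hcard := Fintype.card_le_of_injective _ hinj
  simp only [Fintype.card_fin] at hcard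
  omega

end Literature.Computability.MetaComplexity
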